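import Literature.Analysis.OperatorTheory.Enflo2023.StepRealisationFar
import Literature.Analysis.OperatorTheory.Enflo2023.StepRealisationToy
import HarnessLib

/-!
# Enflo (2023), Part B — the orbit residual fails at the text's modulus over an INVERTIBLE host that is of
type 1 for EVERY vector: the Jordan model `T_{w₀,θ} = w₀(1 + θN)` on `ℂ²` (`StepRealisation.FarJ`)

Source: P. H. Enflo, arXiv:2305.15442v2 — a CLAIMED result under adjudication (b2b-enflo repair cell, formaliser 2).
This file records theorems ABOUT TYPED INFERENCES OF THE TEXT in an explicit finite-dimensional model; nothing here
concludes the invariant subspace problem for any operator (the model operator has exactly one non-trivial invariant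
subspace).  BLOCK-2b value: a second, sharper calibration of the located Part-B residual `StepRealisation.IndepRunD`
— v2 (34) p.16 with ONE modulus along everything the construction visits, p.19 l.655–677 — AT THE TEXT'S MODULUS.

WHAT THIS FILE DECIDES.  `StepRealisationFar` refuted `IndepRunD` at every modulus (so at `σ = δ₂`) over the
type-1 operator `T_{w₀,α²}` of `ℂ³`.  That host is NOT injective and its range is NOT dense (`u₂ ↦ 0`), it is of
type 1 only on the angle cone of `u₀`, and its far starts form the sliver `|x₀,₀|, |x₀,₁| ∈ (0.7, 1/√2]`.  Here the
same σ-independent mechanism (`Far`'s located endgame `hasMCLimit_of_indepRunD`: `IndepRunD` forces a non-cyclic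
vector within `0.7` of `x₀`) is run over a host with none of these features:

* §A THE MODEL `T_{w₀,θ} = w₀(1 + θN)` on `ℂ²` (`FarJ.TJ`; `N u₁ = u₀`, `N u₀ = 0`): `Tʲy = w₀ʲ(y + jθNy)`,
  `⟨Tʲy, y⟩ = w₀ʲ(‖y‖² + jθ·ȳ₁y₀)` (`FarJ.inner_TJ_iterate`).
* §B TYPE 1 FOR EVERY VECTOR (`FarJ.type1_all`, `FarJ.type1`): for `0 < w₀ ≤ 1`, every `n ≥ 1` and EVERY `y`
  (on or off any cone) some `j ∈ {n, n + 1}` has `|⟨Tʲy, y⟩| ≥ (w₀ⁿ⁺¹/(2n + 2))‖y‖²` — a two-point trick on the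
  affine function `j ↦ ‖y‖² + jθȳ₁y₀` (`FarJ.two_point`); so `Referee.Type1 T` with ANY unit `u₀` and
  `δ_n = w₀ⁿ⁺¹/(2n + 2)`.
* §C NORM (`FarJ.opNorm_TJ_eq`: `‖T‖ = w₀‖1 + θN‖ ∈ [w₀, w₀(1 + θ)]`; `FarJ.opNorm_TJ_div`: `w₀ = ν/‖1 + θN‖` gives
  `‖T‖ = ν` exactly).
* §D INVERTIBLE (`FarJ.TJequiv`, `FarJ.bijective`: `T⁻¹ = w₀⁻¹(1 − θN)`), hence injective with dense (indeed full)
  range; and (`FarJ.cyclic_of_ne`, `FarJ.nonCyclic_of_eq`) for `w₀θ ≠ 0` the non-cyclic vectors are EXACTLY the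
  eigenline `ℂu₀` (`{y, Ty}` spans `ℂ²` iff `y₁ ≠ 0`), the only non-trivial invariant subspace.
* §E HENCE (`FarJ.lt_norm_sub_of_orbit_orthogonal`, `FarJ.not_indepRunD_of_far`): a unit `x₀` with `|x₀,₁| > 0.7`
  is more than `0.7` from every non-cyclic vector, so `IndepRunD T x₀ S (ιS S) σ β s₀` is FALSE for every true MC
  start with the run's margin, EVERY modulus `0 < σ ≤ 1`, every ratio `0 < β ≤ σ²/1000`.
* §F NON-VACUITY (`FarJ.exists_far_start`, bracket form as in `DiagN.exists_start` / `Far.exists_far_start`): with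
  `g = (w₀ʲ)_j`, `h = (jw₀ʲ)_j ∈ ℓ²` (`FarJ.hv`; `S†h = w₀(h + g)`, `⟪g, h⟫ = w₀²/(1 − w₀²)²`,
  `‖h‖² ≤ 2/(1 − w₀²)³`) the intertwiner `W b = Y(⟪g, b⟫u₁ + θ⟪h, b⟫u₀)` (`= V_y`, `y = Yu₁`; `WS = TW`,
  `W†x = Yx₁·g + Yθx₀·h`), the seed `ẑ = u₀ + bu₁` with `b = σ/200`, `Y² = 2/b = 400/σ`, `θ = tb`, `0 < t ≤ 1/4`
  give `X̂ = ẑ + WW†ẑ = (1 + 2tb(G₁ + tH₂), b + 2(G₀ + tG₁)) ≈ (1, 2)` and, normalising (`x₀ = X̂/‖X̂‖`,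
  `z = ẑ/‖X̂‖`), a TRUE MC state with `ε² ∈ [0.195, 0.2001]`, `0 < (εθ)₀ = ‖W†z‖² ≤ 0.458b ≤ σ/400`, start
  margin `(22/σ + 1)(εθ)₀ ≤ 0.053`, and `|x₀,₁| ≥ 2/√5.127 > 0.88` — for `0 ≤ w₀ ≤ 1/10`, `0 < σ ≤ 1`,
  `0 < θ ≤ σ/800`.
* §G HEADLINE (`FarJ.fails`, `FarJ.fails_at_text_modulus`): for `0 < w₀ ≤ 1/10`, `0 < σ ≤ 1`, `0 < θ ≤ σ/800` the
  operator `T_{w₀,θ}` is BIJECTIVE, of TYPE 1 (every vector), and has an admissible start — cyclic unit `x₀` MORE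
  THAN `0.88` AWAY FROM EVERY NON-CYCLIC VECTOR, cyclic `y₀ = We₀ = Yu₁` on the axis of the type-1 cone,
  `0 < (εθ)₀ ≤ σ/400`, start margin — at which `IndepRunD` fails with modulus `σ` for every ratio
  `0 < β ≤ σ²/1000`.  At the standing numbers (`FarJ.Tsharp`: `θ♯ = 10⁻⁵¹`, `w♯ = 10⁻²⁰/‖1 + θ♯N‖`, so
  `‖T♯‖ = 10⁻²⁰` EXACTLY) ONE invertible operator serves every `σ ∈ [10⁻⁴⁸, 1]` — a range containing every
  admissible value `≥ 10⁻⁴⁸` of the text's `δ₂ ≤ ‖T‖² = 10⁻⁴⁰`; smaller `σ` are served by `θ ≤ σ/800`.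
* §H THE READING as a distance bound in any Hilbert space (`infDist_nonCyclic_le_of_indepRunD`): `IndepRunD` at an
  admissible start forces `dist(x₀, {non-cyclic vectors of T}) ≤ 0.7`.

READING FOR THE GAP (GAP.md §"Formaliser 2 gen-18" G3/G4).  The hypotheses the text names for
(34)-along-the-construction — type 1 (here for every vector, every cone), `‖T‖ = 10⁻²⁰`, the window, the start
margin, `(εθ)₀ > 0`, cyclic `x₀` and `y₀`, ONE modulus `σ` in the `δ₂`-range — together with INVERTIBILITY of `T`
do not imply it; the deciding quantity is `dist(x₀, non-cyclic vectors)`, which none of them controls, and the set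
of refuting starts is open and large (`|x₀,₁| > 0.7` on the unit sphere of `ℂ²`), not a sliver.  What no
finite-dimensional model can exhibit is the conjunction of ALL standing hypotheses of v2 p.1 (one-to-one, dense
range, NOT onto, `0 ∈ σ(T)`), which forces `dim H = ∞`; and under `¬NIS` — the situation of the refused goal G3 —
no `x₀` is within `0.7` of a non-cyclic vector at all.  This neither refutes nor supports the manuscript's
theorem; it removes "non-injective host / cone-only type 1 / thin set of starts" as possible readings of R34.

Origin: planner-b2b-enflo-2-g23-0 (formaliser 2, gen 23), 2026-08-19.
-/

noncomputable section

open scoped InnerProductSpace ComplexConjugate ENNReal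
open ContinuousLinearMap Filter Topology

namespace Literature.Analysis.OperatorTheory.Enflo2023

namespace StepRealisation

open MCStep Vy DiagN
open Lemma1.Standing (e e_apply norm_e inner_e_left)

namespace FarJ

/-- `ℂ²` (as `EuclideanSpace ℂ (Fin 2)`). [folklore] -/
abbrev C2 : Type := Cd 2

variable {w₀ θ : ℝ}

/-! ### A. The model `T_{w₀,θ} = w₀(1 + θN)` on `ℂ²`: coordinates, iterates, `⟨Tʲy, y⟩` -/

/-- the nilpotent `N : (v₀, v₁) ↦ (v₁, 0)` (`N u₁ = u₀`, `N u₀ = 0`, `N² = 0`). [folklore] -/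
def NJ : C2 →L[ℂ] C2 := (EuclideanSpace.proj (1 : Fin 2) : C2 →L[ℂ] ℂ).smulRight (u 0)

/-- `N v = v₁·u₀`. [folklore] -/
lemma NJ_apply_eq (v : C2) : NJ v = (v 1) • u 0 := by
  simp only [NJ, ContinuousLinearMap.smulRight_apply]
  rfl

/-- `(N v)₀ = v₁`. [folklore] -/
@[simp] lemma NJ_apply_zero (v : C2) : NJ v 0 = v 1 := by
  rw [NJ_apply_eq, PiLp.smul_apply, u_apply]; simp

/-- `(N v)₁ = 0`. [folklore] -/
@[simp] lemma NJ_apply_one (v : C2) : NJ v 1 = 0 := by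
  rw [NJ_apply_eq, PiLp.smul_apply, u_apply]; simp

/-- the unipotent `A_θ = 1 + θN`. [folklore] -/
def AJ (θ : ℝ) : C2 →L[ℂ] C2 := 1 + ((θ : ℝ) : ℂ) • NJ

/-- `(A_θ v)₀ = v₀ + θv₁`. [folklore] -/
@[simp] lemma AJ_apply_zero (v : C2) : AJ θ v 0 = v 0 + ((θ : ℝ) : ℂ) * v 1 := by
  simp only [AJ, _root_.add_apply, one_apply_eq_self,
    _root_.smul_apply, PiLp.add_apply, PiLp.smul_apply, NJ_apply_zero, smul_eq_mul]

/-- `(A_θ v)₁ = v₁`. [folklore] -/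
@[simp] lemma AJ_apply_one (v : C2) : AJ θ v 1 = v 1 := by
  simp only [AJ, _root_.add_apply, one_apply_eq_self,
    _root_.smul_apply, PiLp.add_apply, PiLp.smul_apply, NJ_apply_one, smul_eq_mul, mul_zero,
    add_zero]

/-- THE MODEL OPERATOR `T_{w₀,θ} = w₀(1 + θN) : (v₀, v₁) ↦ (w₀v₀ + w₀θv₁, w₀v₁)` — a single Jordan block with
eigenvalue `w₀`; INVERTIBLE for `w₀ ≠ 0`. [cite: Enflo2023, v2 p.1 (`‖T‖ = 10⁻²⁰`), p.6 (type 1)] -/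
def TJ (w₀ θ : ℝ) : C2 →L[ℂ] C2 := ((w₀ : ℝ) : ℂ) • AJ θ

/-- `(T v)₀ = w₀v₀ + w₀θv₁`. [folklore] -/
@[simp] lemma TJ_apply_zero (v : C2) :
    TJ w₀ θ v 0 = ((w₀ : ℝ) : ℂ) * v 0 + ((w₀ : ℝ) : ℂ) * ((θ : ℝ) : ℂ) * v 1 := by
  simp only [TJ, _root_.smul_apply, PiLp.smul_apply, AJ_apply_zero, smul_eq_mul]; ring

/-- `(T v)₁ = w₀v₁`. [folklore] -/
@[simp] lemma TJ_apply_one (v : C2) : TJ w₀ θ v 1 = ((w₀ : ℝ) : ℂ) * v 1 := by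
  simp only [TJ, _root_.smul_apply, PiLp.smul_apply, AJ_apply_one, smul_eq_mul]

/-- `T u₀ = w₀u₀` (the eigenline `ℂu₀ = ker N = range N`). [folklore] -/
lemma TJ_u_zero : TJ w₀ θ (u 0) = ((w₀ : ℝ) : ℂ) • u 0 := by
  ext j; fin_cases j <;> simp [u_apply]

/-- iterates, second coordinate: `(Tʲy)₁ = w₀ʲy₁`. [folklore] -/
lemma TJ_iterate_apply_one (y : C2) (j : ℕ) : (⇑(TJ w₀ θ))^[j] y 1 = ((w₀ : ℝ) : ℂ) ^ j * y 1 := by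
  induction j with
  | zero => simp
  | succ j ih => rw [Function.iterate_succ_apply', TJ_apply_one, ih]; ring

/-- iterates, first coordinate: `(Tʲy)₀ = w₀ʲ(y₀ + jθy₁)` (`(1 + θN)ʲ = 1 + jθN`). [folklore] -/
lemma TJ_iterate_apply_zero (y : C2) (j : ℕ) :
    (⇑(TJ w₀ θ))^[j] y 0 = ((w₀ : ℝ) : ℂ) ^ j * (y 0 + (j : ℂ) * ((θ : ℝ) : ℂ) * y 1) := by
  induction j with
  | zero => simp
  | succ j ih =>
    rw [Function.iterate_succ_apply', TJ_apply_zero, ih, TJ_iterate_apply_one]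
    push_cast; ring

/-- a coordinate is at most the norm. [folklore] -/
lemma norm_apply_le_C2 (v : C2) (i : Fin 2) : ‖v i‖ ≤ ‖v‖ := by
  have h : ‖v i‖ ^ 2 ≤ ‖v‖ ^ 2 := by
    rw [EuclideanSpace.norm_sq_eq]
    exact Finset.single_le_sum (f := fun k => ‖v k‖ ^ 2) (fun k _ => sq_nonneg _) (Finset.mem_univ i)
  exact (pow_le_pow_iff_left₀ (norm_nonneg _) (norm_nonneg _) two_ne_zero).1 h

/-- **`⟨Tʲy, y⟩ = w₀ʲ(‖y‖² + j·θ·ȳ₁y₀)`** — an AFFINE function of `j` times `w₀ʲ`. [cite: Enflo2023, v2 p.6 (type 1)] -/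
lemma inner_TJ_iterate (y : C2) (j : ℕ) :
    ⟪(⇑(TJ w₀ θ))^[j] y, y⟫_ℂ =
      ((w₀ : ℝ) : ℂ) ^ j * (((‖y‖ ^ 2 : ℝ) : ℂ) + (j : ℂ) * (((θ : ℝ) : ℂ) * (conj (y 1) * y 0))) := by
  rw [PiLp.inner_apply, Fin.sum_univ_two, TJ_iterate_apply_zero, TJ_iterate_apply_one, Toy.norm_sq]
  simp only [RCLike.inner_apply', map_mul, map_pow, map_add, map_natCast, Complex.conj_ofReal]
  push_cast
  rw [← Complex.conj_mul' (y 0), ← Complex.conj_mul' (y 1)]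
  ring

/-! ### B. Type 1 — for EVERY `y`, with `δ_n = w₀ⁿ⁺¹/(2n + 2)` and `j ∈ {n, n + 1}` (a two-point trick) -/

/-- the two-point trick: for `a ≥ 0` and any complex `c`, one of `|a + nc|, |a + (n+1)c|` is `≥ a/(2n + 2)`
(if both were smaller, `|c| < a/(n+1)` and `a ≤ |a + nc| + n|c| < a`). [folklore] -/
lemma two_point {a : ℝ} (ha : 0 ≤ a) (c : ℂ) (n : ℕ) :
    a / (2 * n + 2) ≤ ‖(a : ℂ) + (n : ℂ) * c‖ ∨ a / (2 * n + 2) ≤ ‖(a : ℂ) + ((n : ℂ) + 1) * c‖ := by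
  by_contra h
  push Not at h
  obtain ⟨h1, h2⟩ := h
  set q : ℝ := a / (2 * n + 2) with hq
  set A : ℝ := ‖(a : ℂ) + (n : ℂ) * c‖ with hA
  set B : ℝ := ‖(a : ℂ) + ((n : ℂ) + 1) * c‖ with hB
  have hn : (0 : ℝ) ≤ n := Nat.cast_nonneg n
  have hm : (0 : ℝ) < 2 * n + 2 := by positivity
  have haq : q * (2 * n + 2) = a := by rw [hq]; exact div_mul_cancel₀ a hm.ne'
  have hA0 : 0 ≤ A := norm_nonneg _
  have hc : ‖c‖ ≤ A + B := by
    have e : c = ((a : ℂ) + ((n : ℂ) + 1) * c) - ((a : ℂ) + (n : ℂ) * c) := by ring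
    calc ‖c‖ = ‖((a : ℂ) + ((n : ℂ) + 1) * c) - ((a : ℂ) + (n : ℂ) * c)‖ := by rw [← e]
      _ ≤ B + A := norm_sub_le _ _
      _ = A + B := add_comm _ _
  have ha' : a ≤ A + n * ‖c‖ := by
    have e : (a : ℂ) = ((a : ℂ) + (n : ℂ) * c) - (n : ℂ) * c := by ring
    calc a = ‖(a : ℂ)‖ := by rw [Complex.norm_real, Real.norm_of_nonneg ha]
      _ = ‖((a : ℂ) + (n : ℂ) * c) - (n : ℂ) * c‖ := by rw [← e]
      _ ≤ A + ‖(n : ℂ) * c‖ := norm_sub_le _ _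
      _ = A + n * ‖c‖ := by rw [norm_mul, Complex.norm_natCast]
  have h3 : (n : ℝ) * ‖c‖ ≤ n * (2 * q) := mul_le_mul_of_nonneg_left (by linarith) hn
  linarith

/-- **TYPE 1 FOR EVERY VECTOR**: for every `n` and EVERY `y ∈ ℂ²` there is `j ∈ {n, n+1}` with
`|⟨Tʲy, y⟩| ≥ (w₀ⁿ⁺¹/(2n + 2))‖y‖²` (`0 < w₀ ≤ 1`, any `θ`); no angle condition is needed.
[cite: Enflo2023, v2 p.6 (definition of type 1)] -/
theorem type1_all (hw₀ : 0 < w₀) (hw1 : w₀ ≤ 1) (n : ℕ) (y : C2) :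
    ∃ j, n ≤ j ∧ j ≤ n + 1 ∧ w₀ ^ (n + 1) / (2 * n + 2) * ‖y‖ ^ 2 ≤ ‖⟪(⇑(TJ w₀ θ))^[j] y, y⟫_ℂ‖ := by
  set c : ℂ := ((θ : ℝ) : ℂ) * (conj (y 1) * y 0) with hc
  have key : ∀ j : ℕ, ‖⟪(⇑(TJ w₀ θ))^[j] y, y⟫_ℂ‖ = w₀ ^ j * ‖((‖y‖ ^ 2 : ℝ) : ℂ) + (j : ℂ) * c‖ := by
    intro j
    rw [inner_TJ_iterate, norm_mul, norm_pow, Complex.norm_real, Real.norm_of_nonneg hw₀.le]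
  have hm : (0 : ℝ) < 2 * n + 2 := by positivity
  have hyn : 0 ≤ ‖y‖ ^ 2 / (2 * n + 2) := by positivity
  rcases two_point (sq_nonneg ‖y‖) c n with h | h
  · refine ⟨n, le_rfl, by omega, ?_⟩
    rw [key]
    have hp : w₀ ^ (n + 1) ≤ w₀ ^ n := pow_le_pow_of_le_one hw₀.le hw1 (by omega)
    calc w₀ ^ (n + 1) / (2 * n + 2) * ‖y‖ ^ 2 = w₀ ^ (n + 1) * (‖y‖ ^ 2 / (2 * n + 2)) := by ring
      _ ≤ w₀ ^ n * (‖y‖ ^ 2 / (2 * n + 2)) := mul_le_mul_of_nonneg_right hp hyn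
      _ ≤ w₀ ^ n * ‖((‖y‖ ^ 2 : ℝ) : ℂ) + (n : ℂ) * c‖ := mul_le_mul_of_nonneg_left h (by positivity)
  · refine ⟨n + 1, by omega, le_rfl, ?_⟩
    rw [key, Nat.cast_add_one]
    calc w₀ ^ (n + 1) / (2 * n + 2) * ‖y‖ ^ 2 = w₀ ^ (n + 1) * (‖y‖ ^ 2 / (2 * n + 2)) := by ring
      _ ≤ w₀ ^ (n + 1) * ‖((‖y‖ ^ 2 : ℝ) : ℂ) + ((n : ℂ) + 1) * c‖ :=
          mul_le_mul_of_nonneg_left h (by positivity)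

/-- **THE MODEL IS OF TYPE 1** (v2 p.6) — with ANY unit `u₀` (we take `u₀ = u₁`, the axis on which the start's
`y₀` lies), `δ_n = w₀ⁿ⁺¹/(2n + 2)`, exponent `j ∈ {n, n + 1}`; the inequality holds for every `y`, on the angle
cone and off it. [cite: Enflo2023, v2 p.6 (definition of type 1)] -/
theorem type1 (hw₀ : 0 < w₀) (hw1 : w₀ ≤ 1) : Referee.Type1 (TJ w₀ θ) :=
  ⟨u 1, norm_u 1, fun n _ => ⟨w₀ ^ (n + 1) / (2 * n + 2), by positivity, fun y _ => by
    obtain ⟨j, hj, -, h⟩ := type1_all (θ := θ) hw₀ hw1 n y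
    exact ⟨j, hj, h⟩⟩⟩

/-! ### C. Norm and invertibility: `w₀ ≤ ‖T‖ ≤ w₀(1 + θ)`, `‖T_{ν/‖A_θ‖, θ}‖ = ν`, `T⁻¹ = w₀⁻¹(1 − θN)` -/

/-- `‖N‖ ≤ 1`. [folklore] -/
lemma norm_NJ_le : ‖NJ‖ ≤ 1 := by
  refine ContinuousLinearMap.opNorm_le_bound _ zero_le_one fun v => ?_
  rw [NJ_apply_eq, norm_smul, norm_u, mul_one, one_mul]
  exact norm_apply_le_C2 v 1

/-- `1 ≤ ‖A_θ‖` (`A_θu₀ = u₀`). [folklore] -/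
lemma one_le_norm_AJ : 1 ≤ ‖AJ θ‖ := by
  have h := (AJ θ).le_opNorm (u 0)
  have hA : AJ θ (u 0) = u 0 := by ext j; fin_cases j <;> simp [u_apply]
  rwa [hA, norm_u, mul_one] at h

/-- `‖A_θ‖ ≤ 1 + |θ|`. [folklore] -/
lemma norm_AJ_le : ‖AJ θ‖ ≤ 1 + |θ| := by
  calc ‖AJ θ‖ ≤ ‖(1 : C2 →L[ℂ] C2)‖ + ‖((θ : ℝ) : ℂ) • NJ‖ := norm_add_le _ _
    _ ≤ 1 + |θ| * 1 := by
        gcongr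
        · exact ContinuousLinearMap.norm_id_le
        · rw [norm_smul, Complex.norm_real, Real.norm_eq_abs]
          exact mul_le_mul_of_nonneg_left norm_NJ_le (abs_nonneg θ)
    _ = 1 + |θ| := by ring

/-- `‖T_{w₀,θ}‖ = w₀‖A_θ‖` for `w₀ ≥ 0`. [folklore] -/
lemma opNorm_TJ_eq (hw₀ : 0 ≤ w₀) : ‖TJ w₀ θ‖ = w₀ * ‖AJ θ‖ := by
  rw [TJ, norm_smul, Complex.norm_real, Real.norm_of_nonneg hw₀]

/-- **`w₀ ≤ ‖T_{w₀,θ}‖ ≤ w₀(1 + θ)`** (`w₀, θ ≥ 0`). [cite: Enflo2023, v2 p.1] -/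
theorem opNorm_TJ (hw₀ : 0 ≤ w₀) (hθ : 0 ≤ θ) : w₀ ≤ ‖TJ w₀ θ‖ ∧ ‖TJ w₀ θ‖ ≤ w₀ * (1 + θ) := by
  rw [opNorm_TJ_eq hw₀]
  refine ⟨by nlinarith [one_le_norm_AJ (θ := θ)], mul_le_mul_of_nonneg_left ?_ hw₀⟩
  have h := norm_AJ_le (θ := θ)
  rwa [abs_of_nonneg hθ] at h

/-- **EXACT NORMALISATION**: `‖T_{ν/‖A_θ‖, θ}‖ = ν` (`ν ≥ 0`), e.g. `ν = 10⁻²⁰`. [cite: Enflo2023, v2 p.1 (`‖T‖ = 10⁻²⁰`)] -/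
theorem opNorm_TJ_div {ν : ℝ} (hν : 0 ≤ ν) : ‖TJ (ν / ‖AJ θ‖) θ‖ = ν := by
  have hA : 0 < ‖AJ θ‖ := lt_of_lt_of_le one_pos one_le_norm_AJ
  rw [opNorm_TJ_eq (div_nonneg hν hA.le), div_mul_cancel₀ ν hA.ne']

/-- the inverse `T⁻¹ = w₀⁻¹(1 − θN)`. [folklore] -/
def TJinv (w₀ θ : ℝ) : C2 →L[ℂ] C2 := ((w₀⁻¹ : ℝ) : ℂ) • (1 - ((θ : ℝ) : ℂ) • NJ)

/-- `(T⁻¹ v)₀ = w₀⁻¹(v₀ − θv₁)`. [folklore] -/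
@[simp] lemma TJinv_apply_zero (v : C2) :
    TJinv w₀ θ v 0 = ((w₀⁻¹ : ℝ) : ℂ) * (v 0 - ((θ : ℝ) : ℂ) * v 1) := by
  simp only [TJinv, _root_.smul_apply, _root_.sub_apply,
    one_apply_eq_self, PiLp.smul_apply, PiLp.sub_apply, NJ_apply_zero, smul_eq_mul]

/-- `(T⁻¹ v)₁ = w₀⁻¹v₁`. [folklore] -/
@[simp] lemma TJinv_apply_one (v : C2) : TJinv w₀ θ v 1 = ((w₀⁻¹ : ℝ) : ℂ) * v 1 := by
  simp only [TJinv, _root_.smul_apply, _root_.sub_apply,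
    one_apply_eq_self, PiLp.smul_apply, PiLp.sub_apply, NJ_apply_one, smul_eq_mul, mul_zero,
    sub_zero]

/-- `T⁻¹T = 1`. [folklore] -/
lemma TJinv_TJ (hw₀ : w₀ ≠ 0) (v : C2) : TJinv w₀ θ (TJ w₀ θ v) = v := by
  have hw₀' : ((w₀ : ℝ) : ℂ) ≠ 0 := by exact_mod_cast hw₀
  ext j; fin_cases j
  · simp only [Fin.zero_eta, Fin.isValue, TJinv_apply_zero, TJ_apply_zero, TJ_apply_one]
    push_cast; field_simp; ring
  · simp only [Fin.mk_one, Fin.isValue, TJinv_apply_one, TJ_apply_one]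
    push_cast; field_simp

/-- `TT⁻¹ = 1`. [folklore] -/
lemma TJ_TJinv (hw₀ : w₀ ≠ 0) (v : C2) : TJ w₀ θ (TJinv w₀ θ v) = v := by
  have hw₀' : ((w₀ : ℝ) : ℂ) ≠ 0 := by exact_mod_cast hw₀
  ext j; fin_cases j
  · simp only [Fin.zero_eta, Fin.isValue, TJ_apply_zero, TJinv_apply_zero, TJinv_apply_one]
    push_cast; field_simp; ring
  · simp only [Fin.mk_one, Fin.isValue, TJ_apply_one, TJinv_apply_one]
    push_cast; field_simp

/-- **`T_{w₀,θ}` IS INVERTIBLE** (`w₀ ≠ 0`): a continuous linear automorphism of `ℂ²` — in particular one-to-one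
with dense (indeed full) range, the two standing reductions of v2 p.1 that a finite-dimensional host can meet.
[cite: Enflo2023, v2 p.1 (standing assumptions)] -/
def TJequiv (hw₀ : w₀ ≠ 0) (θ : ℝ) : C2 ≃L[ℂ] C2 :=
  ContinuousLinearEquiv.equivOfInverse (TJ w₀ θ) (TJinv w₀ θ) (TJinv_TJ hw₀) (TJ_TJinv hw₀)

/-- the automorphism is `T_{w₀,θ}`. [folklore] -/
@[simp] lemma coe_TJequiv (hw₀ : w₀ ≠ 0) : (TJequiv hw₀ θ : C2 →L[ℂ] C2) = TJ w₀ θ := rfl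

/-- `T_{w₀,θ}` is bijective (`w₀ ≠ 0`). [folklore] -/
theorem bijective (hw₀ : w₀ ≠ 0) : Function.Bijective (TJ w₀ θ) :=
  (TJequiv hw₀ θ).bijective

/-! ### D. Invariant subspaces: the non-cyclic vectors are EXACTLY the eigenline `ℂu₀`; far vectors stay far -/

/-- **CYCLIC VECTORS**: every `y` with `y₁ ≠ 0` is cyclic (`Ty − w₀y = w₀θy₁·u₀`, then `y` supplies `u₁`;
`w₀, θ ≠ 0`). [cite: Enflo2023, v2 p.3 ("then `y₀` is non-cyclic")] -/
theorem cyclic_of_ne (hw₀ : w₀ ≠ 0) (hθ : θ ≠ 0) {y : C2} (h1 : y 1 ≠ 0) : ¬ IsNonCyclic (TJ w₀ θ) y := by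
  have hw₀' : ((w₀ : ℝ) : ℂ) ≠ 0 := by exact_mod_cast hw₀
  have hθ' : ((θ : ℝ) : ℂ) ≠ 0 := by exact_mod_cast hθ
  intro hnc
  apply hnc
  rw [orbitClosure, eq_top_iff]
  set M : Submodule ℂ C2 := Submodule.span ℂ (Set.range fun j : ℕ => (TJ w₀ θ ^ j) y) with hM
  have hy : y ∈ M := Submodule.subset_span ⟨0, by dsimp only; rw [pow_zero, one_apply_eq_self]⟩
  have hTy : TJ w₀ θ y ∈ M := Submodule.subset_span ⟨1, by dsimp only; rw [pow_one]⟩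
  -- `u₀ ∈ M`
  have hc0 : ((w₀ : ℝ) : ℂ) * ((θ : ℝ) : ℂ) * y 1 ≠ 0 := mul_ne_zero (mul_ne_zero hw₀' hθ') h1
  have hu0 : u 0 ∈ M := by
    have hm : (((w₀ : ℝ) : ℂ) * ((θ : ℝ) : ℂ) * y 1) • u 0 ∈ M := by
      have h : (((w₀ : ℝ) : ℂ) * ((θ : ℝ) : ℂ) * y 1) • u 0 = TJ w₀ θ y - ((w₀ : ℝ) : ℂ) • y := by
        ext i; fin_cases i <;> simp [u_apply]
      rw [h]; exact M.sub_mem hTy (M.smul_mem _ hy)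
    have := M.smul_mem ((((w₀ : ℝ) : ℂ) * ((θ : ℝ) : ℂ) * y 1))⁻¹ hm
    rwa [smul_smul, inv_mul_cancel₀ hc0, one_smul] at this
  -- `u₁ ∈ M`
  have hu1 : u 1 ∈ M := by
    have hm : (y 1) • u 1 ∈ M := by
      have h : (y 1) • u 1 = y - (y 0) • u 0 := by
        ext i; fin_cases i <;> simp [u_apply]
      rw [h]; exact M.sub_mem hy (M.smul_mem _ hu0)
    have := M.smul_mem (y 1)⁻¹ hm
    rwa [smul_smul, inv_mul_cancel₀ h1, one_smul] at this
  intro v _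
  apply M.le_topologicalClosure
  rw [decomp_u v, Fin.sum_univ_two]
  exact M.add_mem (M.smul_mem _ hu0) (M.smul_mem _ hu1)

/-- powers act as iterates. [folklore] -/
lemma pow_apply_eq_iterate (T : C2 →L[ℂ] C2) (y : C2) (j : ℕ) : (T ^ j) y = (⇑T)^[j] y := by
  induction j with
  | zero => rw [pow_zero, one_apply_eq_self, Function.iterate_zero_apply]
  | succ j ih => rw [pow_succ', Function.iterate_succ_apply', ← ih]; rfl

/-- **NON-CYCLIC VECTORS**: every non-zero `y` with `y₁ = 0` (i.e. `y ∈ ℂu₀ ∖ 0`) is non-cyclic — its orbit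
stays in the closed hyperplane `{v : v₁ = 0} ∌ u₁`.  With `cyclic_of_ne`: the non-cyclic vectors of `T_{w₀,θ}`
(`w₀θ ≠ 0`) are exactly `ℂu₀`, its only non-trivial invariant subspace. [folklore] -/
theorem nonCyclic_of_eq {y : C2} (hy1 : y 1 = 0) : IsNonCyclic (TJ w₀ θ) y := by
  intro htop
  set K : Submodule ℂ C2 := LinearMap.ker ((EuclideanSpace.proj (1 : Fin 2) : C2 →L[ℂ] ℂ) : C2 →ₗ[ℂ] ℂ)
    with hK
  have hKc : IsClosed (K : Set C2) := ContinuousLinearMap.isClosed_ker _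
  have hle : orbitClosure (TJ w₀ θ) y ≤ K := by
    rw [orbitClosure]
    refine Submodule.topologicalClosure_minimal _ (Submodule.span_le.2 ?_) hKc
    rintro _ ⟨j, rfl⟩
    show (EuclideanSpace.proj (1 : Fin 2) : C2 →L[ℂ] ℂ) ((TJ w₀ θ ^ j) y) = 0
    rw [pow_apply_eq_iterate]
    show (⇑(TJ w₀ θ))^[j] y 1 = 0
    rw [TJ_iterate_apply_one, hy1, mul_zero]
  have hu1 : (u 1 : C2) ∈ K := hle (by rw [htop]; exact Submodule.mem_top)
  have : (u 1 : C2) 1 = 0 := hu1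
  rw [u_apply] at this
  simp at this

/-- **FAR VECTORS STAY FAR.**  If `x₀ ≠ w` and `x₀ − w ⊥ w, Tw` (`w₀θ ≠ 0`), then `w₁ = 0` (else `{w, Tw}` spans
`ℂ²` and `x₀ = w`), so `‖x₀ − w‖ ≥ |x₀,₁|`: a vector with `|x₀,₁| > m` is more than `m` away from every non-zero
non-cyclic vector. [folklore] -/
theorem lt_norm_sub_of_orbit_orthogonal (hw₀ : w₀ ≠ 0) (hθ : θ ≠ 0) {x₀ w : C2} {m : ℝ} (hq : m < ‖x₀ 1‖)
    (hu : x₀ - w ≠ 0) (h0 : ⟪x₀ - w, w⟫_ℂ = 0) (h1 : ⟪x₀ - w, TJ w₀ θ w⟫_ℂ = 0) : m < ‖x₀ - w‖ := by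
  have hw₀' : ((w₀ : ℝ) : ℂ) ≠ 0 := by exact_mod_cast hw₀
  have hθ' : ((θ : ℝ) : ℂ) ≠ 0 := by exact_mod_cast hθ
  have e0 : conj (x₀ 0 - w 0) * w 0 + conj (x₀ 1 - w 1) * w 1 = 0 := by
    rw [PiLp.inner_apply, Fin.sum_univ_two] at h0
    rw [← h0]
    simp only [PiLp.sub_apply, RCLike.inner_apply']
  have e1 : conj (x₀ 0 - w 0) * w 1 = 0 := by
    rw [PiLp.inner_apply, Fin.sum_univ_two] at h1
    simp only [PiLp.sub_apply, TJ_apply_zero, TJ_apply_one, RCLike.inner_apply'] at h1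
    have h1' : ((w₀ : ℝ) : ℂ) * (conj (x₀ 0 - w 0) * w 0 + conj (x₀ 1 - w 1) * w 1) +
        ((w₀ : ℝ) : ℂ) * ((θ : ℝ) : ℂ) * (conj (x₀ 0 - w 0) * w 1) = 0 := by
      rw [← h1]; simp only [map_sub]; ring
    rw [e0, mul_zero, zero_add] at h1'
    exact (mul_eq_zero.1 h1').resolve_left (mul_ne_zero hw₀' hθ')
  have key : w 1 = 0 → m < ‖x₀ - w‖ := fun hi =>
    lt_of_lt_of_le (by rw [PiLp.sub_apply, hi, sub_zero]; exact hq) (norm_apply_le_C2 (x₀ - w) 1)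
  rcases mul_eq_zero.1 e1 with ha | hb
  · have hpa : x₀ 0 - w 0 = 0 := (map_eq_zero _).1 ha
    rw [hpa, map_zero, zero_mul, zero_add] at e0
    rcases mul_eq_zero.1 e0 with hb' | hb
    · have hqb : x₀ 1 - w 1 = 0 := (map_eq_zero _).1 hb'
      refine absurd ?_ hu
      ext i
      fin_cases i
      · simpa using hpa
      · simpa using hqb
    · exact key hb
  · exact key hb

/-! ### E. Over a far `x₀` the orbit residual fails for every start, every modulus and every ratio -/

/-- **`IndepRunD` FAILS OVER A FAR `x₀`, WHATEVER THE MODULUS** — invertible host.  For `T_{w₀,θ}` (`w₀θ ≠ 0`)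
and a unit `x₀` with `|x₀,₁| > 0.7`, EVERY true MC start `s₀` over `x₀` with the run's start margin refutes
`IndepRunD T x₀ S (ιS S) σ β s₀` (`0 < σ ≤ 1`, `0 < β ≤ σ²/1000`): the endgame would produce a non-cyclic `w` with
`‖x₀ − w‖ ≤ 0.7` (`hasMCLimit_of_indepRunD`), and there is none (`lt_norm_sub_of_orbit_orthogonal`).
[cite: Enflo2023, v2 (34) p.16; p.19 l.655–677; (11) p.4] -/
theorem not_indepRunD_of_far (hw₀ : w₀ ≠ 0) (hθ : θ ≠ 0) {x₀ : C2} (hx₀ : ‖x₀‖ = 1) (hq : 0.7 < ‖x₀ 1‖)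
    {σ β : ℝ} (hσ : 0 < σ) (hσ1 : σ ≤ 1) (hβ0 : 0 < β) (hβ : β ≤ σ ^ 2 / 1000) (s₀ : State (TJ w₀ θ) x₀ S)
    (hstart : (0.09 : ℝ) + (22 / σ + 1) * s₀.etheta ≤ s₀.ε ^ 2 ∧
      s₀.ε ^ 2 + (22 / σ + 1) * s₀.etheta ≤ 0.49) :
    ¬ IndepRunD (TJ w₀ θ) x₀ S (ιS S) σ β s₀ := by
  intro h
  obtain ⟨hιs, hι1, hιS⟩ := ιS_props (Vy.S)
  obtain ⟨w, -, hlo, hhi, horth⟩ :=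
    hasMCLimit_of_indepRunD (TJ w₀ θ) x₀ hx₀ S norm_S_le hιs hι1 hιS hσ hσ1 hβ0 hβ s₀ hstart h
  have h0 : ⟪x₀ - w, w⟫_ℂ = 0 := by simpa using horth 0
  have h1 : ⟪x₀ - w, TJ w₀ θ w⟫_ℂ = 0 := by simpa using horth 1
  have hlt := lt_norm_sub_of_orbit_orthogonal hw₀ hθ hq (sub_ne_zero_of_window hlo) h0 h1
  linarith

/-! ### F. Non-vacuity at the text's modulus: an admissible far start over the invertible host (bracket form) -/

section Ell2
variable {μ : ℝ}

/-- `(j·μʲ)_j` is square-summable for `|μ| < 1`. [folklore] -/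
lemma memℓp_lin_geom (h : |μ| < 1) : Memℓp (fun j : ℕ => (j : ℂ) * ((μ : ℂ)) ^ j) 2 := by
  rw [memℓp_gen_iff (by norm_num : 0 < (2 : ℝ≥0∞).toReal)]
  simp only [ENNReal.toReal_ofNat, Real.rpow_two, norm_mul, norm_pow, Complex.norm_real, Real.norm_eq_abs,
    Complex.norm_natCast]
  have hr : ‖(|μ| ^ 2 : ℝ)‖ < 1 := by
    rw [Real.norm_of_nonneg (by positivity)]; nlinarith [abs_nonneg μ]
  refine (summable_pow_mul_geometric_of_norm_lt_one 2 hr).congr fun j => ?_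
  ring

/-- THE VECTOR `h_μ = (j·μʲ)_j ∈ ℓ²` (`|μ| < 1`; `0` otherwise): with `g_μ`, the coefficient functional of the
Jordan part (`V_y b = ⟪g, b⟫y + θ⟪h, b⟫Ny` for `Tʲy = w₀ʲ(y + jθNy)`). [folklore] -/
def hv (μ : ℝ) : ℓ2 := if h : |μ| < 1 then ⟨fun j => (j : ℂ) * ((μ : ℂ)) ^ j, memℓp_lin_geom h⟩ else 0

/-- coordinates of `h_μ`. [folklore] -/
lemma hv_apply (h : |μ| < 1) (j : ℕ) : hv μ j = (j : ℂ) * (μ : ℂ) ^ j := by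
  rw [hv, dif_pos h]

/-- `⟪h_μ, e_j⟫ = j·μʲ`. [folklore] -/
lemma inner_hv_e (h : |μ| < 1) (j : ℕ) : ⟪hv μ, e j⟫_ℂ = (j : ℂ) * (μ : ℂ) ^ j := by
  rw [Diag.inner_e_right, hv_apply h, map_mul, map_natCast, map_pow, Complex.conj_ofReal]

/-- one coordinate of `⟪h_μ, S b⟫`. [folklore] -/
lemma inner_hv_S_succ (hμ : |μ| < 1) (b : ℓ2) (j : ℕ) :
    ⟪hv μ (j + 1), S b (j + 1)⟫_ℂ = (μ : ℂ) * (⟪hv μ j, b j⟫_ℂ + ⟪Diag.gv μ j, b j⟫_ℂ) := by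
  rw [S_apply_succ, hv_apply hμ, hv_apply hμ, Diag.gv_apply hμ, pow_succ]
  simp only [RCLike.inner_apply', map_mul, map_pow, map_add, map_one, map_natCast, Complex.conj_ofReal,
    Nat.cast_succ]
  ring

/-- `S†h_μ = μ(h_μ + g_μ)`: `⟪h_μ, S b⟫ = μ(⟪h_μ, b⟫ + ⟪g_μ, b⟫)`. [folklore] -/
lemma inner_hv_S (hμ : |μ| < 1) (b : ℓ2) :
    ⟪hv μ, S b⟫_ℂ = (μ : ℂ) * (⟪hv μ, b⟫_ℂ + ⟪Diag.gv μ, b⟫_ℂ) := by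
  have hs : Summable fun j => ⟪hv μ j, S b j⟫_ℂ := lp.summable_inner (hv μ) (S b)
  have h1 : Summable fun j => ⟪hv μ j, b j⟫_ℂ := lp.summable_inner (hv μ) b
  have h2 : Summable fun j => ⟪Diag.gv μ j, b j⟫_ℂ := lp.summable_inner (Diag.gv μ) b
  rw [lp.inner_eq_tsum, lp.inner_eq_tsum, lp.inner_eq_tsum, hs.tsum_eq_zero_add]
  have h0' : ⟪hv μ 0, S b 0⟫_ℂ = 0 := by rw [S_apply_zero, inner_zero_right]
  rw [h0', zero_add, ← h1.tsum_add h2, ← tsum_mul_left]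
  exact tsum_congr fun j => inner_hv_S_succ hμ b j

/-- THE MIXED GRAM VALUE `⟪g_μ, h_μ⟫ = Σ jμ²ʲ = μ²/(1 − μ²)²`. [folklore] -/
lemma inner_gv_hv (hμ : |μ| < 1) : ⟪Diag.gv μ, hv μ⟫_ℂ = (((μ ^ 2 / (1 - μ ^ 2) ^ 2 : ℝ)) : ℂ) := by
  rw [lp.inner_eq_tsum]
  have hξ : ‖((μ ^ 2 : ℝ) : ℂ)‖ < 1 := by
    rw [Complex.norm_real, Real.norm_of_nonneg (sq_nonneg μ)]; nlinarith [abs_nonneg μ, sq_abs μ]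
  have h := tsum_coe_mul_geometric_of_norm_lt_one hξ
  have e : (fun j : ℕ => ⟪Diag.gv μ j, hv μ j⟫_ℂ) = fun j : ℕ => (j : ℂ) * ((μ ^ 2 : ℝ) : ℂ) ^ j := by
    funext j
    rw [Diag.gv_apply hμ, hv_apply hμ]
    simp only [RCLike.inner_apply', map_pow, Complex.conj_ofReal]
    push_cast
    ring
  rw [e, h]
  push_cast
  ring

/-- `⟪h_μ, g_μ⟫ = μ²/(1 − μ²)²`. [folklore] -/
lemma inner_hv_gv (hμ : |μ| < 1) : ⟪hv μ, Diag.gv μ⟫_ℂ = (((μ ^ 2 / (1 - μ ^ 2) ^ 2 : ℝ)) : ℂ) := by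
  rw [← inner_conj_symm, inner_gv_hv hμ, Complex.conj_ofReal]

/-- THE GRAM BOUND `‖h_μ‖² = Σ j²μ²ʲ ≤ 2Σ C(j+2, 2)μ²ʲ = 2/(1 − μ²)³` (`j² ≤ (j + 2)(j + 1)`). [folklore] -/
lemma norm_hv_sq_le (hμ : |μ| < 1) : ‖hv μ‖ ^ 2 ≤ 2 / (1 - μ ^ 2) ^ 3 := by
  have hr : ‖(μ ^ 2 : ℝ)‖ < 1 := by
    rw [Real.norm_of_nonneg (sq_nonneg μ)]; nlinarith [abs_nonneg μ, sq_abs μ]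
  have hf := lp.hasSum_norm (by norm_num : 0 < (2 : ℝ≥0∞).toReal) (hv μ)
  simp only [ENNReal.toReal_ofNat, Real.rpow_two] at hf
  have hg := (hasSum_choose_mul_geometric_of_norm_lt_one 2 hr).mul_left 2
  have hle : ∀ j : ℕ, ‖hv μ j‖ ^ 2 ≤ 2 * ((((j + 2).choose 2 : ℕ) : ℝ) * (μ ^ 2) ^ j) := by
    intro j
    have hc : ((j : ℝ)) ^ 2 ≤ 2 * (((j + 2).choose 2 : ℕ) : ℝ) := by
      rw [Nat.cast_choose_two]; push_cast; nlinarith [(Nat.cast_nonneg j : (0 : ℝ) ≤ j)]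
    have hp : 0 ≤ (μ ^ 2) ^ j := pow_nonneg (sq_nonneg μ) j
    have habs : (|μ| ^ j) ^ 2 = (μ ^ 2) ^ j := by rw [← pow_mul, mul_comm, pow_mul, sq_abs]
    rw [hv_apply hμ, norm_mul, norm_pow, Complex.norm_natCast, Complex.norm_real, Real.norm_eq_abs, mul_pow,
      habs, ← mul_assoc]
    exact mul_le_mul_of_nonneg_right hc hp
  calc ‖hv μ‖ ^ 2 ≤ 2 * (1 / (1 - μ ^ 2) ^ (2 + 1)) := hasSum_le hle hf hg
    _ = 2 / (1 - μ ^ 2) ^ 3 := by ring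

end Ell2

variable {Y b : ℝ}

/-- THE MODEL INTERTWINERS `W b' = Y(⟪g_{w₀}, b'⟫u₁ + θ⟪h_{w₀}, b'⟫u₀)` (`W = V_y` for `y = We₀ = Yu₁`:
`Σ b'ⱼTʲy = Y(Σ b'ⱼw₀ʲ)u₁ + Yθ(Σ jb'ⱼw₀ʲ)u₀`). [cite: Enflo2023, v2 (2)–(4) p.2] -/
def WJ (w₀ θ Y : ℝ) : ℓ2 →L[ℂ] C2 :=
  ((Y : ℝ) : ℂ) • ((innerSL ℂ (Diag.gv w₀)).smulRight (u 1) +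
    ((θ : ℝ) : ℂ) • (innerSL ℂ (hv w₀)).smulRight (u 0))

/-- `W b'` expanded. [folklore] -/
lemma WJ_apply_eq (b' : ℓ2) : WJ w₀ θ Y b' =
    (((Y : ℝ) : ℂ) * ⟪Diag.gv w₀, b'⟫_ℂ) • u 1 + (((Y : ℝ) : ℂ) * ((θ : ℝ) : ℂ) * ⟪hv w₀, b'⟫_ℂ) • u 0 := by
  simp only [WJ, _root_.add_apply, _root_.smul_apply, ContinuousLinearMap.smulRight_apply, innerSL_apply_apply,
    smul_smul, smul_add, mul_assoc]

/-- `(W b')₀ = Yθ⟪h, b'⟫`. [folklore] -/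
@[simp] lemma WJ_apply_zero (b' : ℓ2) :
    WJ w₀ θ Y b' 0 = ((Y : ℝ) : ℂ) * ((θ : ℝ) : ℂ) * ⟪hv w₀, b'⟫_ℂ := by
  rw [WJ_apply_eq]; simp [u_apply]

/-- `(W b')₁ = Y⟪g, b'⟫`. [folklore] -/
@[simp] lemma WJ_apply_one (b' : ℓ2) : WJ w₀ θ Y b' 1 = ((Y : ℝ) : ℂ) * ⟪Diag.gv w₀, b'⟫_ℂ := by
  rw [WJ_apply_eq]; simp [u_apply]

/-- `W` INTERTWINES: `W S = T_{w₀,θ} W` (`S†g = w₀g`, `S†h = w₀(h + g)` against `T = w₀(1 + θN)`).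
[cite: Enflo2023, v2 (2)–(4) p.2] -/
lemma WJ_intertwine (hw : |w₀| < 1) (b' : ℓ2) : WJ w₀ θ Y (S b') = TJ w₀ θ (WJ w₀ θ Y b') := by
  ext j
  fin_cases j
  · simp only [Fin.zero_eta, Fin.isValue, WJ_apply_zero, inner_hv_S hw, TJ_apply_zero, WJ_apply_one]
    ring
  · simp only [Fin.mk_one, Fin.isValue, WJ_apply_one, Diag.inner_gv_S hw, TJ_apply_one]
    ring

/-- `y₀ = We₀ = Yu₁`. [folklore] -/
lemma WJ_e_zero (hw : |w₀| < 1) : WJ w₀ θ Y (e 0) = ((Y : ℝ) : ℂ) • u 1 := by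
  ext j
  fin_cases j
  · simp [inner_hv_e hw 0, u_apply]
  · simp [Diag.inner_gv_e hw 0, u_apply]

/-- `W†` in coordinates: `W†x = (Yx₁)·g_{w₀} + (Yθx₀)·h_{w₀}`. [cite: Enflo2023, v2 (4) p.2] -/
lemma adjoint_WJ (x : C2) : adjoint (WJ w₀ θ Y) x =
    (((Y : ℝ) : ℂ) * x 1) • Diag.gv w₀ + (((Y : ℝ) : ℂ) * ((θ : ℝ) : ℂ) * x 0) • hv w₀ := by
  refine ext_inner_right ℂ fun b' => ?_
  rw [adjoint_inner_left, PiLp.inner_apply, Fin.sum_univ_two, WJ_apply_zero, WJ_apply_one]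
  simp only [inner_add_left, inner_smul_left, RCLike.inner_apply', map_mul, Complex.conj_ofReal]
  ring

/-- the bracket seed `ẑ = u₀ + b·u₁`. [folklore] -/
def zh (b : ℝ) : C2 := u 0 + ((b : ℝ) : ℂ) • u 1

/-- `ẑ₀ = 1`. [folklore] -/
@[simp] lemma zh_apply_zero : zh b 0 = 1 := by simp [zh, u_apply]
/-- `ẑ₁ = b`. [folklore] -/
@[simp] lemma zh_apply_one : zh b 1 = ((b : ℝ) : ℂ) := by simp [zh, u_apply]

/-- `‖ẑ‖² = 1 + b²`. [folklore] -/
lemma norm_zh_sq : ‖zh b‖ ^ 2 = 1 + b ^ 2 := by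
  rw [Toy.norm_sq, zh_apply_zero, zh_apply_one, Complex.norm_real, Real.norm_eq_abs, sq_abs]; simp

/-- `W†ẑ = (Yb)·g + (Yθ)·h`. [folklore] -/
lemma adjoint_WJ_zh : adjoint (WJ w₀ θ Y) (zh b) =
    ((Y * b : ℝ) : ℂ) • Diag.gv w₀ + ((Y * θ : ℝ) : ℂ) • hv w₀ := by
  rw [adjoint_WJ, zh_apply_zero, zh_apply_one, mul_one]; push_cast; rfl

/-- the Gram numbers `G₀ = ‖g‖² = 1/(1 − w₀²)`, `G₁ = ⟪g, h⟫ = w₀²/(1 − w₀²)²`, `H₂ = ‖h‖²`. [folklore] -/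
def G0 (w₀ : ℝ) : ℝ := (1 - w₀ ^ 2)⁻¹
/-- `G₁ = w₀²/(1 − w₀²)²`. [folklore] -/
def G1 (w₀ : ℝ) : ℝ := w₀ ^ 2 / (1 - w₀ ^ 2) ^ 2
/-- `H₂ = ‖h_{w₀}‖²` (irreducible: keeps `whnf` away from the `ℓ²` norm in the arithmetic below). [folklore] -/
irreducible_def H2 (w₀ : ℝ) : ℝ := ‖hv w₀‖ ^ 2

/-- `⟪g, g⟫ = G₀`. [folklore] -/
lemma inner_gg (hw : |w₀| < 1) : ⟪Diag.gv w₀, Diag.gv w₀⟫_ℂ = ((G0 w₀ : ℝ) : ℂ) := by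
  rw [Diag.inner_gv_gv hw hw, G0, sq]
/-- `⟪h, h⟫ = H₂`. [folklore] -/
lemma inner_hh : ⟪hv w₀, hv w₀⟫_ℂ = ((H2 w₀ : ℝ) : ℂ) := by
  rw [H2_def, inner_self_eq_norm_sq_to_K]; norm_cast
/-- `⟪g, h⟫ = G₁`. [folklore] -/
lemma inner_gh (hw : |w₀| < 1) : ⟪Diag.gv w₀, hv w₀⟫_ℂ = ((G1 w₀ : ℝ) : ℂ) := by rw [inner_gv_hv hw, G1]
/-- `⟪h, g⟫ = G₁`. [folklore] -/
lemma inner_hg (hw : |w₀| < 1) : ⟪hv w₀, Diag.gv w₀⟫_ℂ = ((G1 w₀ : ℝ) : ℂ) := by rw [inner_hv_gv hw, G1]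

/-- bounds on the Gram numbers for `0 ≤ w₀ ≤ 1/10`: `1 ≤ G₀ ≤ 1.0102`, `0 ≤ G₁ ≤ 0.0103`, `0 ≤ H₂ ≤ 2.0613`.
[folklore] -/
lemma gram_bounds (hw₀ : 0 ≤ w₀) (hw1 : w₀ ≤ 1 / 10) :
    1 ≤ G0 w₀ ∧ G0 w₀ ≤ 1.0102 ∧ 0 ≤ G1 w₀ ∧ G1 w₀ ≤ 0.0103 ∧ 0 ≤ H2 w₀ ∧ H2 w₀ ≤ 2.0613 := by
  have hw : |w₀| < 1 := abs_lt.2 ⟨by linarith, by linarith⟩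
  have hr : w₀ ^ 2 ≤ 1 / 100 := by nlinarith
  have hr0 : 0 ≤ w₀ ^ 2 := sq_nonneg w₀
  have h1r : (99 / 100 : ℝ) ≤ 1 - w₀ ^ 2 := by linarith
  refine ⟨?_, ?_, by rw [G1]; positivity, ?_, by rw [H2_def]; positivity, ?_⟩
  · rw [G0, le_inv_comm₀ one_pos (by linarith), inv_one]; linarith
  · rw [G0, inv_le_comm₀ (by linarith) (by norm_num)]; linarith
  · rw [G1, div_le_iff₀ (by positivity)]; nlinarith
  · calc H2 w₀ ≤ 2 / (1 - w₀ ^ 2) ^ 3 := by rw [H2_def]; exact norm_hv_sq_le hw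
      _ ≤ 2 / (99 / 100) ^ 3 := by gcongr
      _ ≤ 2.0613 := by norm_num

/-- THE BRACKET VECTOR `X̂ = ẑ + WW†ẑ` in coordinates, with `Y²b = 2` and `θ = tb`:
`X̂₀ = 1 + 2tb(G₁ + tH₂)`, `X̂₁ = b + 2(G₀ + tG₁)`. [cite: Enflo2023, v2 (5) p.3] -/
lemma bracket_apply (hw : |w₀| < 1) {t : ℝ} (hθ : θ = t * b) (hY : Y ^ 2 * b = 2) :
    (zh b + WJ w₀ θ Y (adjoint (WJ w₀ θ Y) (zh b))) 0 = ((1 + 2 * t * b * (G1 w₀ + t * H2 w₀) : ℝ) : ℂ) ∧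
    (zh b + WJ w₀ θ Y (adjoint (WJ w₀ θ Y) (zh b))) 1 = ((b + 2 * (G0 w₀ + t * G1 w₀) : ℝ) : ℂ) := by
  have hY' : ((Y : ℝ) : ℂ) ^ 2 * ((b : ℝ) : ℂ) = 2 := by exact_mod_cast hY
  rw [adjoint_WJ_zh, map_add, map_smul, map_smul]
  constructor
  · simp only [Fin.isValue, PiLp.add_apply, PiLp.smul_apply, zh_apply_zero, WJ_apply_zero, inner_hg hw, inner_hh,
      smul_eq_mul, hθ]
    push_cast
    linear_combination (t * ↑b * (↑(G1 w₀) : ℂ) + t * t * ↑b * ↑(H2 w₀)) * hY'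
  · simp only [Fin.isValue, PiLp.add_apply, PiLp.smul_apply, zh_apply_one, WJ_apply_one, inner_gg hw, inner_gh hw,
      smul_eq_mul, hθ]
    push_cast
    linear_combination ((↑(G0 w₀) : ℂ) + t * ↑(G1 w₀)) * hY'

/-- `‖W†ẑ‖² = Y²(b²G₀ + 2bθG₁ + θ²H₂) = 2b(G₀ + 2tG₁ + t²H₂)`. [cite: Enflo2023, v2 (16) p.6] -/
lemma norm_adjoint_zh_sq (hw : |w₀| < 1) {t : ℝ} (hθ : θ = t * b) (hY : Y ^ 2 * b = 2) :
    ‖adjoint (WJ w₀ θ Y) (zh b)‖ ^ 2 = 2 * b * (G0 w₀ + 2 * t * G1 w₀ + t ^ 2 * H2 w₀) := by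
  rw [adjoint_WJ_zh, @norm_add_sq ℂ, norm_smul, norm_smul, inner_smul_left, inner_smul_right, inner_gh hw,
    mul_pow, mul_pow, Complex.norm_real, Complex.norm_real, Real.norm_eq_abs, Real.norm_eq_abs, sq_abs, sq_abs,
    Complex.conj_ofReal]
  have hg : ‖Diag.gv w₀‖ ^ 2 = G0 w₀ := by rw [Diag.norm_gv_sq hw, G0, sq]
  have hh : ‖hv w₀‖ ^ 2 = H2 w₀ := (H2_def w₀).symm
  rw [hg, hh, hθ]
  have hre : RCLike.re (((Y * b : ℝ) : ℂ) * (((Y * (t * b) : ℝ) : ℂ) * ((G1 w₀ : ℝ) : ℂ))) =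
      Y ^ 2 * b * (t * b) * G1 w₀ := by
    rw [RCLike.re_to_complex, ← Complex.ofReal_mul, ← Complex.ofReal_mul, Complex.ofReal_re]; ring
  rw [hre]
  have e1 : (Y * b) ^ 2 = 2 * b := by nlinarith
  have e2 : (Y * (t * b)) ^ 2 = 2 * b * t ^ 2 := by nlinarith
  have e3 : Y ^ 2 * b * (t * b) = 2 * (t * b) := by rw [hY]
  rw [e1, e2, e3]; ring

/-- the start's arithmetic (`b = σ/200 ≤ 1/200`, `0 < t ≤ 1/4`, Gram bounds): `X̂₀ ∈ [1, 1.0014]`,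
`X̂₁ ∈ [2, 2.0306]`, `‖W†ẑ‖² ≤ 2.29b`. [folklore] -/
lemma start_arith (hw₀ : 0 ≤ w₀) (hw1 : w₀ ≤ 1 / 10) {t : ℝ} (ht : 0 < t) (ht1 : t ≤ 1 / 4) (hb : 0 < b)
    (hb1 : b ≤ 1 / 200) :
    1 ≤ 1 + 2 * t * b * (G1 w₀ + t * H2 w₀) ∧ 1 + 2 * t * b * (G1 w₀ + t * H2 w₀) ≤ 1.0014 ∧
    2 ≤ b + 2 * (G0 w₀ + t * G1 w₀) ∧ b + 2 * (G0 w₀ + t * G1 w₀) ≤ 2.0306 ∧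
    2 * b * (G0 w₀ + 2 * t * G1 w₀ + t ^ 2 * H2 w₀) ≤ 2.29 * b := by
  obtain ⟨hG0, hG0', hG1, hG1', hH2, hH2'⟩ := gram_bounds hw₀ hw1
  have hA : G1 w₀ + t * H2 w₀ ≤ 0.0103 + 1 / 4 * 2.0613 := by nlinarith
  have hA0 : 0 ≤ G1 w₀ + t * H2 w₀ := by positivity
  have htb : t * b ≤ 1 / 4 * (1 / 200) := mul_le_mul ht1 hb1 hb.le (by norm_num)
  have htb0 : 0 ≤ t * b := by positivity
  have hP : t * b * (G1 w₀ + t * H2 w₀) ≤ 1 / 4 * (1 / 200) * (0.0103 + 1 / 4 * 2.0613) :=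
    mul_le_mul htb hA hA0 (by norm_num)
  have hB : t * G1 w₀ ≤ 1 / 4 * 0.0103 := mul_le_mul ht1 hG1' hG1 (by norm_num)
  have hC : t ^ 2 * H2 w₀ ≤ (1 / 4) ^ 2 * 2.0613 :=
    mul_le_mul (pow_le_pow_left₀ ht.le ht1 2) hH2' hH2 (by positivity)
  refine ⟨by nlinarith, by nlinarith, by nlinarith, by nlinarith, ?_⟩
  have h := mul_le_mul_of_nonneg_left
    (show G0 w₀ + 2 * t * G1 w₀ + t ^ 2 * H2 w₀ ≤ 1.0102 + 2 * (1 / 4 * 0.0103) + (1 / 4) ^ 2 * 2.0613 by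
      nlinarith) (show (0 : ℝ) ≤ 2 * b by positivity)
  nlinarith

/-- **AN ADMISSIBLE FAR START EXISTS** over the invertible host `T_{w₀,θ}` (`0 ≤ w₀ ≤ 1/10`, `0 < σ ≤ 1`,
`0 < θ ≤ σ/800`): a unit `x₀` with `|x₀,₁| > 0.88` — so MORE THAN `0.88` AWAY FROM EVERY NON-CYCLIC VECTOR — and a
TRUE MC state `s₀` of `W = V_{y₀}`, `y₀ = Yu₁` (`Y = √(400/σ)`), over it, with `ε² ∈ [0.195, 0.2001]`,
`0 < (εθ)₀ ≤ σ/400` and the run's start margin `(22/σ + 1)(εθ)₀ ≤ 0.053`.  Bracket form: `ẑ = u₀ + (σ/200)u₁`,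
`x₀ = X̂/‖X̂‖`, `X̂ = ẑ + WW†ẑ ≈ (1, 2)`.
[cite: Enflo2023, v2 (2)–(5) p.2–3, (15)–(16) p.6, p.17 (window), p.19 l.661–677 (margin)] -/
theorem exists_far_start (hw₀ : 0 ≤ w₀) (hw1 : w₀ ≤ 1 / 10) (hθ : 0 < θ) {σ : ℝ} (hσ : 0 < σ) (hσ1 : σ ≤ 1)
    (hθσ : θ ≤ σ / 800) :
    ∃ (x₀ : C2) (s₀ : State (TJ w₀ θ) x₀ S), ‖x₀‖ = 1 ∧ 0.88 < ‖x₀ 1‖ ∧ 0 < s₀.etheta ∧ s₀.etheta ≤ σ / 400 ∧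
      ((0.09 : ℝ) + (22 / σ + 1) * s₀.etheta ≤ s₀.ε ^ 2 ∧ s₀.ε ^ 2 + (22 / σ + 1) * s₀.etheta ≤ 0.49) ∧
      s₀.V = WJ w₀ θ (Real.sqrt (400 / σ)) ∧ s₀.V (e 0) = ((Real.sqrt (400 / σ) : ℝ) : ℂ) • u 1 := by
  have hw : |w₀| < 1 := abs_lt.2 ⟨by linarith, by linarith⟩
  -- the numbers `b = σ/200`, `t = θ/b ≤ 1/4`, `Y = √(400/σ)` (`Y²b = 2`)
  set b : ℝ := σ / 200 with hbdef
  have hb : 0 < b := by positivity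
  have hb1 : b ≤ 1 / 200 := by rw [hbdef]; linarith
  set t : ℝ := θ / b with htdef
  have ht : 0 < t := by positivity
  have hθt : θ = t * b := by rw [htdef, div_mul_cancel₀ θ hb.ne']
  have ht1 : t ≤ 1 / 4 := by
    rw [htdef, div_le_iff₀ hb, hbdef]; linarith
  set Y : ℝ := Real.sqrt (400 / σ) with hYdef
  have hY2 : Y ^ 2 = 400 / σ := Real.sq_sqrt (by positivity)
  have hY0 : 0 < Y := Real.sqrt_pos.2 (by positivity)
  have hYb : Y ^ 2 * b = 2 := by rw [hY2, hbdef]; field_simp; ring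
  obtain ⟨hP0lo, hP0hi, hP1lo, hP1hi, hE⟩ := start_arith (b := b) hw₀ hw1 ht ht1 hb hb1
  -- the intertwiner
  obtain ⟨W, hW⟩ : ∃ W : ℓ2 →L[ℂ] C2, WJ w₀ θ Y = W := ⟨_, rfl⟩
  have hWS : ∀ b', W (S b') = TJ w₀ θ (W b') := by rw [← hW]; exact WJ_intertwine hw
  -- the bracket vector `X̂` and the scale `l = 1/‖X̂‖`
  obtain ⟨X, hX⟩ : ∃ X : C2, zh b + W (adjoint W (zh b)) = X := ⟨_, rfl⟩
  obtain ⟨hX0, hX1⟩ := bracket_apply (w₀ := w₀) (Y := Y) hw hθt hYb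
  rw [hW, hX] at hX0 hX1
  obtain ⟨P0, hP0⟩ : ∃ P : ℝ, 1 + 2 * t * b * (G1 w₀ + t * H2 w₀) = P := ⟨_, rfl⟩
  obtain ⟨P1, hP1⟩ : ∃ P : ℝ, b + 2 * (G0 w₀ + t * G1 w₀) = P := ⟨_, rfl⟩
  rw [hP0] at hX0 hP0lo hP0hi
  rw [hP1] at hX1 hP1lo hP1hi
  obtain ⟨nX, hnX⟩ : ∃ n : ℝ, ‖X‖ = n := ⟨_, rfl⟩
  have hXn : nX ^ 2 = P0 ^ 2 + P1 ^ 2 := by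
    rw [← hnX, Toy.norm_sq, hX0, hX1, Complex.norm_real, Complex.norm_real, Real.norm_eq_abs, Real.norm_eq_abs,
      sq_abs, sq_abs]
  have hXlo : 5 ≤ nX ^ 2 := by rw [hXn]; nlinarith only [hP0lo, hP1lo]
  have hXhi : nX ^ 2 ≤ 5.127 := by rw [hXn]; nlinarith only [hP0lo, hP0hi, hP1lo, hP1hi]
  have hN0 : 0 < nX :=
    lt_of_pow_lt_pow_left₀ 2 (hnX ▸ norm_nonneg X) (by rw [zero_pow two_ne_zero]; linarith only [hXlo])
  obtain ⟨l, hl⟩ : ∃ l : ℝ, nX⁻¹ = l := ⟨_, rfl⟩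
  have hl0 : 0 < l := by rw [← hl]; exact inv_pos.2 hN0
  have hlN : l * nX = 1 := by rw [← hl]; exact inv_mul_cancel₀ hN0.ne'
  have hl2 : l ^ 2 * nX ^ 2 = 1 := by rw [← mul_pow, hlN, one_pow]
  have hl2lo : 1 / 5.127 ≤ l ^ 2 := by
    have h := mul_le_mul_of_nonneg_left hXhi (sq_nonneg l)
    rw [div_le_iff₀ (by norm_num)]; linarith
  have hl2hi : l ^ 2 ≤ 1 / 5 := by
    have h := mul_le_mul_of_nonneg_left hXlo (sq_nonneg l)
    rw [le_div_iff₀ (by norm_num)]; linarith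
  -- `x₀`, `z`, the bracket
  obtain ⟨x₀, hx₀⟩ : ∃ x₀ : C2, ((l : ℝ) : ℂ) • X = x₀ := ⟨_, rfl⟩
  obtain ⟨z, hz⟩ : ∃ z : C2, ((l : ℝ) : ℂ) • zh b = z := ⟨_, rfl⟩
  have hx₀n : ‖x₀‖ = 1 := by
    rw [← hx₀, norm_smul, Complex.norm_real, Real.norm_of_nonneg hl0.le, hnX, hlN]
  have hzn : ‖z‖ ^ 2 = (1 + b ^ 2) * l ^ 2 := by
    rw [← hz, norm_smul, Complex.norm_real, Real.norm_of_nonneg hl0.le, mul_pow, norm_zh_sq]; ring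
  have hb2 : b ^ 2 * l ^ 2 ≤ 1 / 40000 * (1 / 5) :=
    mul_le_mul (by nlinarith only [hb, hb1]) hl2hi (sq_nonneg l) (by norm_num)
  have hb2' : 0 ≤ b ^ 2 * l ^ 2 := mul_nonneg (sq_nonneg b) (sq_nonneg l)
  have hzlo : 0.195 ≤ ‖z‖ ^ 2 := by rw [hzn]; linarith only [hl2lo, hb2']
  have hzhi : ‖z‖ ^ 2 ≤ 0.2001 := by rw [hzn]; linarith only [hl2hi, hb2]
  have hz0 : 0 < ‖z‖ :=
    lt_of_pow_lt_pow_left₀ 2 (norm_nonneg _) (by rw [zero_pow two_ne_zero]; linarith only [hzlo])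
  have hbr : IsBracket W x₀ z := by
    show z + W (adjoint W z) = x₀
    rw [← hz, map_smul, map_smul, ← smul_add, hX, hx₀]
  have hwin : (0.3 : ℝ) ≤ ‖z‖ ∧ ‖z‖ ≤ 0.7 := Far.window_of_sq' hz0 (by linarith only [hzlo]) (by linarith only [hzhi])
  have hEz : ‖adjoint W z‖ ^ 2 = l ^ 2 * (2 * b * (G0 w₀ + 2 * t * G1 w₀ + t ^ 2 * H2 w₀)) := by
    rw [← hz, map_smul, norm_smul, mul_pow, Complex.norm_real, Real.norm_of_nonneg hl0.le, ← hW,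
      norm_adjoint_zh_sq hw hθt hYb]
  -- far: `|x₀,₁| = l·X̂₁ ≥ 2l > 0.88`
  have hx1 : ‖x₀ 1‖ = l * P1 := by
    rw [← hx₀, PiLp.smul_apply, hX1, smul_eq_mul, norm_mul, Complex.norm_real, Complex.norm_real,
      Real.norm_of_nonneg hl0.le, Real.norm_of_nonneg (by linarith)]
  have hfar : (0.88 : ℝ) < l * P1 := by
    have h2l : 2 * l ≤ l * P1 := by nlinarith only [hl0, hP1lo]
    have : (0.88 : ℝ) < 2 * l := lt_of_pow_lt_pow_left₀ 2 (by positivity) (by nlinarith only [hl2lo])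
    linarith
  -- the state
  let s₀ : State (TJ w₀ θ) x₀ S := ⟨W, hWS, ‖z‖, hwin, _, hbr.isMinimal⟩
  have hv : s₀.v = z := hbr.sub_eq
  have he : s₀.etheta = l ^ 2 * (2 * b * (G0 w₀ + 2 * t * G1 w₀ + t ^ 2 * H2 w₀)) := by
    rw [etheta_eq_eth, hv, eth_eq_of_isBracket hbr, hEz]
  have hε : s₀.ε ^ 2 = ‖z‖ ^ 2 := rfl
  obtain ⟨hG0, -, hG1, -, hH2, -⟩ := gram_bounds hw₀ hw1
  have hG0' : 0 < G0 w₀ := by linarith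
  have hsum : 0 < G0 w₀ + 2 * t * G1 w₀ + t ^ 2 * H2 w₀ := by positivity
  have hepos : 0 < l ^ 2 * (2 * b * (G0 w₀ + 2 * t * G1 w₀ + t ^ 2 * H2 w₀)) := by positivity
  have hehi : l ^ 2 * (2 * b * (G0 w₀ + 2 * t * G1 w₀ + t ^ 2 * H2 w₀)) ≤ 0.458 * b := by
    calc l ^ 2 * (2 * b * (G0 w₀ + 2 * t * G1 w₀ + t ^ 2 * H2 w₀)) ≤ (1 / 5) * (2.29 * b) :=
          mul_le_mul hl2hi hE (by positivity) (by norm_num)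
      _ = 0.458 * b := by ring
  have hK : (22 / σ + 1) * (0.458 * b) ≤ 0.0527 := by
    have h22 : (22 / σ + 1) * (0.458 * b) = 0.458 * (22 + σ) / 200 := by
      rw [hbdef]; field_simp
    rw [h22]; linarith only [hσ1]
  have hK' : (22 / σ + 1) * s₀.etheta ≤ 0.0527 := by
    rw [he]; exact (mul_le_mul_of_nonneg_left hehi (by positivity)).trans hK
  refine ⟨x₀, s₀, hx₀n, by rw [hx1]; exact hfar, by rw [he]; exact hepos, ?_, ⟨?_, ?_⟩, hW.symm, ?_⟩
  · rw [he]
    calc _ ≤ 0.458 * b := hehi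
      _ ≤ σ / 400 := by rw [hbdef]; linarith only [hσ]
  · rw [hε]; linarith only [hK', hzlo]
  · rw [hε]; linarith only [hK', hzhi]
  · show W (e 0) = _
    rw [← hW, WJ_e_zero hw]

/-! ### G. Headline: over an invertible, type-1-for-every-vector host the orbit residual fails non-vacuously at
every modulus — including the text's `δ₂` — from starts `0.88`-far from EVERY non-cyclic vector -/

/-- **THE ORBIT RESIDUAL FAILS AT EVERY MODULUS `0 < σ ≤ 1`, NON-VACUOUSLY, OVER THE INVERTIBLE HOST.**  For
`T_{w₀,θ} = w₀(1 + θN)` on `ℂ²` (`0 < w₀ ≤ 1/10`, `0 < θ ≤ σ/800`) — bijective, of type 1 for every vector — there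
is an admissible start (a CYCLIC unit `x₀` at distance `> 0.88` from every non-cyclic vector; a TRUE MC state with
`0 < (εθ)₀ ≤ σ/400` and the run's start margin; `y₀ = V e₀ = Yu₁` cyclic and on the axis of the type-1 cone) at
which `IndepRunD T x₀ S (ιS S) σ β s₀` is FALSE for every ratio `0 < β ≤ σ²/1000`.
[cite: Enflo2023, v2 (34) p.16; p.19 l.655–677; (45) p.19; (11) p.4] -/
theorem fails (hw₀ : 0 < w₀) (hw1 : w₀ ≤ 1 / 10) (hθ : 0 < θ) {σ : ℝ} (hσ : 0 < σ) (hσ1 : σ ≤ 1)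
    (hθσ : θ ≤ σ / 800) :
    Function.Bijective (TJ w₀ θ) ∧ Referee.Type1 (TJ w₀ θ) ∧
    ∃ (x₀ : C2) (s₀ : State (TJ w₀ θ) x₀ S), ‖x₀‖ = 1 ∧ ¬ IsNonCyclic (TJ w₀ θ) x₀ ∧
      (∀ y : C2, IsNonCyclic (TJ w₀ θ) y → 0.88 < ‖x₀ - y‖) ∧
      0 < s₀.etheta ∧ s₀.etheta ≤ σ / 400 ∧
      ((0.09 : ℝ) + (22 / σ + 1) * s₀.etheta ≤ s₀.ε ^ 2 ∧ s₀.ε ^ 2 + (22 / σ + 1) * s₀.etheta ≤ 0.49) ∧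
      ¬ IsNonCyclic (TJ w₀ θ) (s₀.V (e 0)) ∧
      ∀ β : ℝ, 0 < β → β ≤ σ ^ 2 / 1000 → ¬ IndepRunD (TJ w₀ θ) x₀ S (ιS S) σ β s₀ := by
  obtain ⟨x₀, s₀, hx₀, hq, he, he', hm, -, hy⟩ := exists_far_start hw₀.le hw1 hθ hσ hσ1 hθσ
  have hY : Real.sqrt (400 / σ) ≠ 0 := (Real.sqrt_pos.2 (by positivity)).ne'
  have hfar : ∀ y : C2, IsNonCyclic (TJ w₀ θ) y → 0.88 < ‖x₀ - y‖ := fun y hyc => by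
    have hy1 : y 1 = 0 := by
      by_contra h
      exact cyclic_of_ne hw₀.ne' hθ.ne' h hyc
    exact lt_of_lt_of_le (by rw [PiLp.sub_apply, hy1, sub_zero]; exact hq) (norm_apply_le_C2 (x₀ - y) 1)
  have hx1 : x₀ 1 ≠ 0 := fun h0 => by rw [h0, norm_zero] at hq; norm_num at hq
  have hy1 : s₀.V (e 0) 1 ≠ 0 := by
    rw [hy, PiLp.smul_apply, u_apply, if_pos rfl, smul_eq_mul, mul_one]; exact Complex.ofReal_ne_zero.2 hY
  exact ⟨bijective hw₀.ne', type1 hw₀ (by linarith), x₀, s₀, hx₀, cyclic_of_ne hw₀.ne' hθ.ne' hx1, hfar, he, he',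
    hm, cyclic_of_ne hw₀.ne' hθ.ne' hy1,
    fun β hβ0 hβ => not_indepRunD_of_far hw₀.ne' hθ.ne' hx₀ (by linarith) hσ hσ1 hβ0 hβ s₀ hm⟩

/-- THE STANDING OPERATOR `T♯ = T_{w♯, θ♯}` with `θ♯ = 10⁻⁵¹` and `w♯ = 10⁻²⁰/‖A_{θ♯}‖`, so that `‖T♯‖ = 10⁻²⁰`
EXACTLY (`w♯ ∈ [10⁻²⁰/(1 + 10⁻⁵¹), 10⁻²⁰]`). [cite: Enflo2023, v2 p.1 (`‖T‖ = 10⁻²⁰`)] -/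
def Tsharp : C2 →L[ℂ] C2 := TJ (1e-20 / ‖AJ (1e-51 : ℝ)‖) 1e-51

/-- `0 < w♯ ≤ 10⁻²⁰`. [folklore] -/
lemma wsharp_bounds : 0 < (1e-20 : ℝ) / ‖AJ (1e-51 : ℝ)‖ ∧ (1e-20 : ℝ) / ‖AJ (1e-51 : ℝ)‖ ≤ 1e-20 := by
  have hA : 1 ≤ ‖AJ (1e-51 : ℝ)‖ := one_le_norm_AJ
  exact ⟨by positivity, div_le_self (by norm_num) hA⟩

/-- **… IN PARTICULAR AT THE TEXT'S OWN MODULUS, OVER AN INVERTIBLE `T` WITH `‖T‖ = 10⁻²⁰`.**  `T♯` is a continuous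
linear BIJECTION of `ℂ²` (one-to-one, onto), `‖T♯‖ = 10⁻²⁰`, of type 1 FOR EVERY VECTOR with
`δ_n = w♯ⁿ⁺¹/(2n + 2)` (`w♯ ≥ 10⁻²⁰/(1 + 10⁻⁵¹)`; every type-1 constant at a level `≥ 2` is `≤ ‖T‖² = 10⁻⁴⁰`);
and for EVERY modulus `10⁻⁴⁸ ≤ σ ≤ 1` — so for every admissible value `≥ 10⁻⁴⁸` of the text's `δ₂` — there is an
admissible start (cyclic `x₀` MORE THAN `0.88` AWAY FROM EVERY NON-CYCLIC VECTOR, cyclic `y₀` on the cone axis,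
`0 < (εθ)₀ ≤ σ/400`, start margin) at which `IndepRunD` fails with modulus `σ` and any ratio `0 < β ≤ σ²/1000`.
(Smaller `σ`: take `θ ≤ σ/800` in `fails`.) [cite: Enflo2023, v2 p.1, p.6, (34) p.16, p.19 l.655–677] -/
theorem fails_at_text_modulus {σ : ℝ} (hσ : (1e-48 : ℝ) ≤ σ) (hσ1 : σ ≤ 1) :
    Function.Bijective Tsharp ∧ ‖Tsharp‖ = 1e-20 ∧ Referee.Type1 Tsharp ∧
    ∃ (x₀ : C2) (s₀ : State Tsharp x₀ S), ‖x₀‖ = 1 ∧ ¬ IsNonCyclic Tsharp x₀ ∧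
      (∀ y : C2, IsNonCyclic Tsharp y → 0.88 < ‖x₀ - y‖) ∧
      0 < s₀.etheta ∧ s₀.etheta ≤ σ / 400 ∧
      ((0.09 : ℝ) + (22 / σ + 1) * s₀.etheta ≤ s₀.ε ^ 2 ∧ s₀.ε ^ 2 + (22 / σ + 1) * s₀.etheta ≤ 0.49) ∧
      ¬ IsNonCyclic Tsharp (s₀.V (e 0)) ∧
      ∀ β : ℝ, 0 < β → β ≤ σ ^ 2 / 1000 → ¬ IndepRunD Tsharp x₀ S (ιS S) σ β s₀ := by
  obtain ⟨h0, h1⟩ := wsharp_bounds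
  obtain ⟨hb, ht, h⟩ := fails (θ := 1e-51) h0 (h1.trans (by norm_num)) (by norm_num)
    (lt_of_lt_of_le (by norm_num) hσ) hσ1 (by linarith)
  exact ⟨hb, opNorm_TJ_div (by norm_num), ht, h⟩

end FarJ

/-! ### H. Reading for the located gap (GAP.md §"Formaliser 2 gen-18", G3/G4 (iii)/(iv)) -/

/-- a vector whose orbit is orthogonal to a non-zero vector is non-cyclic (any inner-product space). [folklore] -/
theorem isNonCyclic_of_orbit_orthogonal {H : Type*} [NormedAddCommGroup H] [InnerProductSpace ℂ H]
    (T : H →L[ℂ] H) {y x : H} (hx : x ≠ 0) (horth : ∀ j : ℕ, ⟪x, (T ^ j) y⟫_ℂ = 0) : IsNonCyclic T y := by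
  intro htop
  have hle : orbitClosure T y ≤ (ℂ ∙ x)ᗮ := by
    refine Submodule.topologicalClosure_minimal _ ?_ (Submodule.isClosed_orthogonal _)
    rw [Submodule.span_le]
    rintro _ ⟨j, rfl⟩
    rw [SetLike.mem_coe, Submodule.mem_orthogonal_singleton_iff_inner_left, ← inner_conj_symm, horth j, map_zero]
  have hx' : x ∈ (ℂ ∙ x)ᗮ := hle (htop ▸ Submodule.mem_top)
  rw [Submodule.mem_orthogonal_singleton_iff_inner_left, inner_self_eq_zero] at hx'
  exact hx hx'

/-- **DISTANCE TO THE NON-CYCLIC VECTORS IS WHAT DECIDES `IndepRunD` AT THE TEXT'S MODULUS — NOT INVERTIBILITY,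
NOT THE TYPE-1 CONE, NOT A THIN SET OF STARTS.**  Restatement of `exists_nonCyclic_near_of_indepRunD` as a
distance bound, for any Hilbert space: if `IndepRunD` holds at an admissible start over `x₀` (any `0 < σ ≤ 1`,
`0 < β ≤ σ²/1000`) then `dist(x₀, {non-cyclic vectors of T}) ≤ 0.7`.  `FarJ.fails_at_text_modulus` exhibits an
invertible type-1-for-every-vector `T` with `‖T‖ = 10⁻²⁰` and admissible starts with this distance `> 0.88` at
every modulus in the `δ₂`-range. [cite: Enflo2023, v2 (34) p.16, p.19 l.655–677, (11) p.4, p.20–22] -/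
theorem infDist_nonCyclic_le_of_indepRunD {E H : Type*} [NormedAddCommGroup E] [InnerProductSpace ℂ E]
    [CompleteSpace E] [NormedAddCommGroup H] [InnerProductSpace ℂ H] [CompleteSpace H] {P : Type*}
    [NormedAddCommGroup P] [NormedSpace ℝ P] [CompleteSpace P] (T : H →L[ℂ] H) (x₀ : H) (hx₀ : ‖x₀‖ = 1)
    (S : E →L[ℂ] E) (hS : ‖S‖ ≤ 1) {ι : P →+ (E →L[ℂ] E)} (hιs : ∀ (t : ℝ) (p : P), ι (t • p) = (t : ℂ) • ι p)
    (hι1 : ∀ p, ‖ι p‖ ≤ ‖p‖) (hιS : ∀ p, ι p ∘L S = S ∘L ι p) {σ β : ℝ} (hσ : 0 < σ) (hσ1 : σ ≤ 1)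
    (hβ0 : 0 < β) (hβ : β ≤ σ ^ 2 / 1000) (s₀ : State T x₀ S)
    (hstart : (0.09 : ℝ) + (22 / σ + 1) * s₀.etheta ≤ s₀.ε ^ 2 ∧
      s₀.ε ^ 2 + (22 / σ + 1) * s₀.etheta ≤ 0.49)
    (h : IndepRunD T x₀ S ι σ β s₀) :
    Metric.infDist x₀ {w : H | IsNonCyclic T w} ≤ 0.7 := by
  obtain ⟨w, -, hhi, hu, horth⟩ :=
    exists_nonCyclic_near_of_indepRunD T x₀ hx₀ S hS hιs hι1 hιS hσ hσ1 hβ0 hβ s₀ hstart h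
  calc Metric.infDist x₀ {w : H | IsNonCyclic T w} ≤ dist x₀ w :=
        Metric.infDist_le_dist_of_mem (isNonCyclic_of_orbit_orthogonal T hu horth)
    _ = ‖x₀ - w‖ := dist_eq_norm _ _
    _ ≤ 0.7 := hhi

end StepRealisation

end Literature.Analysis.OperatorTheory.Enflo2023

end
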